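import Mathlib
import Summits.PneNP.PneNP.Theorems.ChebyshevTracialDesignJuntaCount
import HarnessLib

/-!
# Half-degree lemma, part B: the window of a vertex set and its traces

Support file for the crux `TracialDecayExp20` (stmt-PneNP-19878) of route `ChebyshevTracialDesign`
(cell pnp-psdrank; prover R1-SKELETON S3(ii) «deg_c σ_k ≤ k/2»; p1 ROUND-2 §2(v) HALF-DEGREE LEMMA).

For a perfect matching `M` of `S` and `A ⊆ S`, the *window* of `A` is `E = {e ∈ M : e ∩ A ≠ ∅}` with covered vertex
set `W ⊇ A` (`subset_window`). The traces `B` with `A ⊆ B ⊆ W` correspond bijectively to the sets `Q` of window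
edges internal to `B` (`E₂ ⊆ Q ⊆ E`, `E₂` = edges inside `A`): `B ↦ Q(B) = {e ∈ E : e ⊆ B}`, `Q ↦ A ∪ V(Q)`
(`trace_eq_union_verts`, `filter_union_verts_eq`), with `#cr(B,E) = |E \ Q|`, `#in(B,E) = |Q|`, and every crossing
window edge of such a trace meets `A` exactly once. Consequence (`sum_traces_eq_sum_placements`): a trace sum
`Σ_{A ⊆ B ⊆ W} 2^{-#cr(B,E)} F(#cr, #in)` is the placement sum `Σ_{Q ⊆ E} (∏_{E\Q} κ) F(|E\Q|, |Q|)` of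
`ChebyshevTracialDesignHalfDegreeAtoms` with `κ_e = 1/2` (edge met once by `A`) or `0` (edge inside `A`).
Part C (`ChebyshevTracialDesignHalfDegree`) combines this with the fibre counts of the junta files.
No definitions (everything inline, notation as in `ChebyshevTracialDesignJuntaCount`).
-/

set_option linter.dupNamespace false -- `Summit.PneNP.PneNP.…`: summit = sub-problem (D-0017)

namespace Summit.PneNP.PneNP.Theorems.ChebyshevTracialDesignHalfDegree

open Finset

/-! ## Part B — the level sums of a monomial against a perfect matching

For a perfect matching `M` of `S` and `A ⊆ S`, the *window* of `A` is `E = {e ∈ M : e ∩ A ≠ ∅}` (covered vertex set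
`W ⊇ A`); `κ e = 1/2` on the edges met once by `A`, `κ e = 0` on the edges inside `A`, weights `w e = |A ∩ e|`
(`Σ_e w e = |A|`). The traces `B` with `A ⊆ B ⊆ W` correspond to the sets `Q` of internal window edges
(`E₂ ⊆ Q ⊆ E`), with `#cr(B,E) = |E \ Q|`, `#in(B,E) = |Q|`; summing the fibre counts of part A of the junta files
(`card_fiber_eq`) over the traces gives `Σ_{U : #cr = c, #in = i} 1[A ⊆ U] = T(|M|;c,i)·H_E(c)/[|M|]_{|E|}`, and the
placement polynomial `H_E` has degree `≤ ⌊|A|/2⌋` by part A of this file pair. -/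

section Window

open Literature.Barriers.PneNP Summit.PneNP.PneNP.Theorems.ChebyshevTracialDesignJunta

variable {V : Type*} [DecidableEq V]

/-- For a non-loop pair, `cutCount B e = 2` iff both endpoints lie in `B`. [folklore] -/
theorem cutCount_eq_two_iff {B : Finset V} {e : Sym2 V} (he : ¬e.IsDiag) :
    cutCount B e = 2 ↔ ∀ v ∈ e, v ∈ B := by
  induction e using Sym2.ind with
  | h a b =>
    rw [Sym2.mk_isDiag_iff] at he
    rw [cutCount_mk]
    constructor
    · intro h v hv
      rcases Sym2.mem_iff.1 hv with rfl | rfl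
      · by_contra hv'; rw [if_neg hv'] at h; split_ifs at h <;> omega
      · by_contra hv'; rw [if_neg hv'] at h; split_ifs at h <;> omega
    · intro h
      rw [if_pos (h a (Sym2.mem_mk_left a b)), if_pos (h b (Sym2.mem_mk_right a b))]

/-- `cutCount B e ≠ 0` iff some endpoint lies in `B`. [folklore] -/
theorem cutCount_ne_zero_iff {B : Finset V} {e : Sym2 V} :
    cutCount B e ≠ 0 ↔ ∃ v ∈ e, v ∈ B := by
  induction e using Sym2.ind with
  | h a b =>
    rw [cutCount_mk]
    constructor
    · intro h
      by_cases ha : a ∈ B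
      · exact ⟨a, Sym2.mem_mk_left a b, ha⟩
      · by_cases hb : b ∈ B
        · exact ⟨b, Sym2.mem_mk_right a b, hb⟩
        · rw [if_neg ha, if_neg hb] at h; exact absurd rfl h
    · rintro ⟨v, hv, hvB⟩
      rcases Sym2.mem_iff.1 hv with rfl | rfl
      · rw [if_pos hvB]; omega
      · rw [if_pos hvB]; omega

/-- Monotonicity: a pair inside `A ⊆ B` is inside `B`. [folklore] -/
theorem cutCount_eq_two_mono {A B : Finset V} (hAB : A ⊆ B) {e : Sym2 V} (he : ¬e.IsDiag)
    (h : cutCount A e = 2) : cutCount B e = 2 :=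
  (cutCount_eq_two_iff he).2 fun v hv => hAB ((cutCount_eq_two_iff he).1 h v hv)

/-- An edge meeting `A ⊆ B` meets `B`: `cutCount B e ∈ {1,2}`. [folklore] -/
theorem cutCount_ne_zero_mono {A B : Finset V} (hAB : A ⊆ B) {e : Sym2 V} (h : cutCount A e ≠ 0) :
    cutCount B e ≠ 0 := by
  obtain ⟨v, hv, hvA⟩ := cutCount_ne_zero_iff.1 h
  exact cutCount_ne_zero_iff.2 ⟨v, hv, hAB hvA⟩

/-- `A` lies in the vertex set covered by its window `E = {e ∈ M : e ∩ A ≠ ∅}`. [folklore] -/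
theorem subset_window {S A : Finset V} {M : Finset (Sym2 V)} (hM : IsPMOn S M) (hA : A ⊆ S) :
    A ⊆ S.filter fun v => ∃ e ∈ M.filter (fun e => cutCount A e ≠ 0), v ∈ e := by
  intro a ha
  obtain ⟨e, he, hae⟩ := hM.exists_mem (hA ha)
  exact mem_filter.2 ⟨hA ha, e, mem_filter.2 ⟨he, cutCount_ne_zero_iff.2 ⟨a, hae, ha⟩⟩, hae⟩

/-- The window edges split by their trace on `B ⊇ A` into crossing and internal ones:
`#cr(B,E) + #in(B,E) = |E|`. [folklore] -/
theorem card_cr_add_card_in_window {A B : Finset V} {M : Finset (Sym2 V)} (hAB : A ⊆ B) :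
    ((M.filter fun e => cutCount A e ≠ 0).filter fun e => cutCount B e = 1).card +
      ((M.filter fun e => cutCount A e ≠ 0).filter fun e => cutCount B e = 2).card =
        (M.filter fun e => cutCount A e ≠ 0).card := by
  rw [← card_union_of_disjoint (disjoint_filter.2 fun e _ h1 h2 => by omega), ← filter_or]
  congr 1
  refine filter_true_of_mem fun e he => ?_
  have h0 := cutCount_ne_zero_mono hAB (mem_filter.1 he).2
  have h2 := cutCount_le_two B e
  omega

/-- Round trip 1: a trace `B` with `A ⊆ B ⊆ W` is recovered from its internal window edges `Q(B)` as
`A ∪ V(Q(B))`. [folklore] -/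
theorem trace_eq_union_verts {S A B : Finset V} {M : Finset (Sym2 V)} (hM : IsPMOn S M) (hAB : A ⊆ B)
    (hBW : B ⊆ S.filter fun v => ∃ e ∈ M.filter (fun e => cutCount A e ≠ 0), v ∈ e) :
    A ∪ S.filter (fun v => ∃ e ∈ (M.filter fun e => cutCount A e ≠ 0).filter (fun e => cutCount B e = 2), v ∈ e) =
      B := by
  ext v
  simp only [mem_union, mem_filter]
  constructor
  · rintro (hv | ⟨-, e, ⟨⟨heM, -⟩, h2⟩, hve⟩)
    · exact hAB hv
    · exact (cutCount_eq_two_iff (hM.not_isDiag heM)).1 h2 v hve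
  · intro hvB
    by_cases hvA : v ∈ A
    · exact Or.inl hvA
    · right
      obtain ⟨hvS, e, he, hve⟩ := mem_filter.1 (hBW hvB)
      obtain ⟨heM, hA0⟩ := mem_filter.1 he
      refine ⟨hvS, e, ⟨⟨heM, hA0⟩, ?_⟩, hve⟩
      obtain ⟨a, hae, haA⟩ := cutCount_ne_zero_iff.1 hA0
      have hav : a ≠ v := fun h => hvA (h ▸ haA)
      have hea : e = s(a, v) := (Sym2.mem_and_mem_iff hav).1 ⟨hae, hve⟩
      rw [hea, cutCount_mk, if_pos (hAB haA), if_pos hvB]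

/-- Round trip 2: a set `Q` of window edges containing the edges inside `A` is recovered from the trace
`A ∪ V(Q)` as its internal window edges. [folklore] -/
theorem filter_union_verts_eq {S A : Finset V} {M Q : Finset (Sym2 V)} (hM : IsPMOn S M)
    (hQ : Q ⊆ M.filter fun e => cutCount A e ≠ 0)
    (h2 : (M.filter fun e => cutCount A e ≠ 0).filter (fun e => cutCount A e = 2) ⊆ Q) :
    ((M.filter fun e => cutCount A e ≠ 0).filter fun e =>
        cutCount (A ∪ S.filter fun v => ∃ e ∈ Q, v ∈ e) e = 2) = Q := by
  ext e
  simp only [mem_filter]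
  constructor
  · rintro ⟨⟨heM, hA0⟩, hB2⟩
    have hall := (cutCount_eq_two_iff (hM.not_isDiag heM)).1 hB2
    by_cases hA2 : cutCount A e = 2
    · exact h2 (mem_filter.2 ⟨mem_filter.2 ⟨heM, hA0⟩, hA2⟩)
    · -- some endpoint of `e` is outside `A`, hence covered by an edge of `Q`, which must be `e`
      have : ∃ v ∈ e, v ∉ A := by
        by_contra hcon
        exact hA2 ((cutCount_eq_two_iff (hM.not_isDiag heM)).2 fun v hv => by_contra fun hvA => hcon ⟨v, hv, hvA⟩)
      obtain ⟨v, hve, hvA⟩ := this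
      rcases mem_union.1 (hall v hve) with hvA' | hvQ
      · exact absurd hvA' hvA
      · obtain ⟨-, e', he'Q, hve'⟩ := mem_filter.1 hvQ
        have he'M : e' ∈ M := (mem_filter.1 (hQ he'Q)).1
        rwa [hM.unique heM he'M hve hve']
  · intro heQ
    obtain ⟨heM, hA0⟩ := mem_filter.1 (hQ heQ)
    refine ⟨⟨heM, hA0⟩, (cutCount_eq_two_iff (hM.not_isDiag heM)).2 fun v hv => ?_⟩
    exact mem_union.2 (Or.inr (mem_filter.2 ⟨hM.mem_of_mem heM hv, e, heQ, hv⟩))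

/-- On a crossing window edge of a trace `B ⊇ A`, `A` meets the edge exactly once (`κ = 1/2`). [folklore] -/
theorem cutCount_eq_one_of_cr {A B : Finset V} {M : Finset (Sym2 V)} (hAB : A ⊆ B)
    (hnd : ∀ e ∈ M, ¬e.IsDiag) {e : Sym2 V}
    (he : e ∈ (M.filter fun e => cutCount A e ≠ 0) \ (M.filter fun e => cutCount A e ≠ 0).filter
      fun e => cutCount B e = 2) :
    cutCount A e = 1 := by
  obtain ⟨he1, he2⟩ := mem_sdiff.1 he
  obtain ⟨heM, hA0⟩ := mem_filter.1 he1
  have hle := cutCount_le_two A e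
  have hA2 : cutCount A e ≠ 2 := fun h =>
    he2 (mem_filter.2 ⟨he1, cutCount_eq_two_mono hAB (hnd e heM) h⟩)
  omega

/-- **The trace sum as a placement sum**: for `A ⊆ S` with window `E`, covered set `W`, and any weights,
`Σ_{A ⊆ B ⊆ W} 2^{-#cr(B,E)}·F(#cr(B,E), #in(B,E)) = Σ_{Q ⊆ E} (∏_{E\Q} κ)·F(|E\Q|, |Q|)` with
`κ e = 1/2` if `|A ∩ e| = 1` and `0` otherwise. [folklore] -/
theorem sum_traces_eq_sum_placements {S A : Finset V} {M : Finset (Sym2 V)} (hM : IsPMOn S M) (hA : A ⊆ S)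
    (F : ℕ → ℕ → ℝ) :
    ∑ B ∈ (S.filter fun v => ∃ e ∈ M.filter (fun e => cutCount A e ≠ 0), v ∈ e).powerset.filter (fun B => A ⊆ B),
        (1 / 2 : ℝ) ^ ((M.filter fun e => cutCount A e ≠ 0).filter fun e => cutCount B e = 1).card *
          F ((M.filter fun e => cutCount A e ≠ 0).filter fun e => cutCount B e = 1).card
            ((M.filter fun e => cutCount A e ≠ 0).filter fun e => cutCount B e = 2).card =
      ∑ Q ∈ (M.filter fun e => cutCount A e ≠ 0).powerset,
        (∏ e ∈ (M.filter fun e => cutCount A e ≠ 0) \ Q, (if cutCount A e = 1 then (1 / 2 : ℝ) else 0)) *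
          F ((M.filter fun e => cutCount A e ≠ 0) \ Q).card Q.card := by
  set E := M.filter fun e => cutCount A e ≠ 0 with hE
  set W := S.filter fun v => ∃ e ∈ E, v ∈ e with hW
  set E₂ := E.filter fun e => cutCount A e = 2 with hE₂
  -- placements `Q` not containing `E₂` contribute `0`
  rw [← sum_filter_of_ne (s := E.powerset) (p := fun Q => E₂ ⊆ Q) (fun Q hQ hne => ?_)]
  swap
  · by_contra hsub
    obtain ⟨e, he₂, heQ⟩ := not_subset.1 hsub
    obtain ⟨heE, hA2⟩ := mem_filter.1 he₂
    refine hne ?_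
    rw [prod_eq_zero (mem_sdiff.2 ⟨heE, heQ⟩) (by rw [if_neg (by omega)]), zero_mul]
  -- the bijection `B ↦ Q(B) = internal window edges`, inverse `Q ↦ A ∪ V(Q)`
  refine sum_nbij' (fun B => E.filter fun e => cutCount B e = 2)
    (fun Q => A ∪ S.filter fun v => ∃ e ∈ Q, v ∈ e) ?_ ?_ ?_ ?_ ?_
  · intro B hB
    rw [mem_filter, mem_powerset] at hB ⊢
    exact ⟨filter_subset _ _, fun e he => mem_filter.2 ⟨(mem_filter.1 he).1,
      cutCount_eq_two_mono hB.2 (hM.not_isDiag (mem_filter.1 (mem_filter.1 he).1).1) (mem_filter.1 he).2⟩⟩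
  · intro Q hQ
    rw [mem_filter, mem_powerset] at hQ ⊢
    refine ⟨union_subset (subset_window hM hA) fun v hv => ?_, subset_union_left⟩
    obtain ⟨hvS, e, heQ, hve⟩ := mem_filter.1 hv
    exact mem_filter.2 ⟨hvS, e, hQ.1 heQ, hve⟩
  · intro B hB
    rw [mem_filter, mem_powerset] at hB
    exact trace_eq_union_verts hM hB.2 hB.1
  · intro Q hQ
    rw [mem_filter, mem_powerset] at hQ
    exact filter_union_verts_eq hM hQ.1 hQ.2
  · intro B hB
    rw [mem_filter, mem_powerset] at hB
    have hsplit := card_cr_add_card_in_window (M := M) hB.2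
    have hcr : (E.filter fun e => cutCount B e = 1).card = (E \ E.filter fun e => cutCount B e = 2).card := by
      rw [card_sdiff_of_subset (filter_subset _ _)]
      rw [← hE] at hsplit
      omega
    rw [hcr]
    congr 1
    rw [prod_congr rfl fun e he => if_pos (cutCount_eq_one_of_cr hB.2 (fun e he => hM.not_isDiag he) he),
      prod_const]

end Window

end Summit.PneNP.PneNP.Theorems.ChebyshevTracialDesignHalfDegree
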